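import Literature.AnabelianGeometry.EtaleTheta.ContH1CoeffChange
import HarnessLib

/-!
# Continuous `H¹`: push-forward of the COEFFICIENTS along a homomorphism of ambient pairs
# `ψ : (G′, A) → (G″, A″)` (support file for [EtTh] §1, Remark 1.6.4)

Neukirch–Schmidt–Wingberg, *Cohomology of Number Fields*, I §2 / II §7: `H¹(H, −)` is a functor in the
`H`-module [cite: NeukirchSchmidtWingberg2008, I §2 and II §7].  In the tree's concrete carrier `ContH1 φ A H`
(`ContH1.lean`, abc-iut-L2-t1: continuous crossed homomorphisms `H → A`, `H ≤ G` acting on the abelian normal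
`A ≤ G′` by conjugation THROUGH `φ : G →* G′`) the available coefficient functorialities are: along an inclusion
`A ≤ A′` inside the SAME `G′` (`ContH1CoeffChange`, abc-iut-w4-d014), along an equivariant endomorphism of `A`
(`ContH1CoeffEndo`, abc-iut-L2-t6), and along a change of `φ` with the same action (`ContH1ActionCongr`).  None of
them changes the AMBIENT PAIR.  [EtTh] Remark 1.6.4 (PRIMS p. 252, «determines, by profinite completion, a set
of classes … ∈ H¹(Π_{Ÿ^∧}, Δ_Θ)» [cite: MochizukiEtTh2009, Rmk 1.6.4 pp.252-253]) compares `Δ_Θ`-valued classes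
on the tempered side (`Δ_Θ ≤ (Π^tp_X)^Θ`) with classes valued in the image `ι(Δ_Θ) ≤ ((Π^tp_X)^Θ)^∧` of `Δ_Θ`
in a profinite completion `ι` — a change of ambient pair `(G′, A) → (G″, A″)` along a continuous homomorphism
`ψ : G′ → G″` with `ψ(A) ≤ A″`.  This file supplies that push-forward (abc-iut cell, seat abc-iut-w6-d081 gen 12;
row «RMK164-D4/D5», L2 VNEXT add.13 spec v2 — the «coefficient identification» step; DEF-BEARING generic API
in the style of `ContH1CoeffEndo`; no instance, no notation, no `Prop` fact):
* `ContH1.mapCoeffCocycle`, **`ContH1.mapCoeff ψ hψ hA : ContH1 φ A H →* ContH1 (ψ.comp φ) A″ H`** (`f ↦ ψ ∘ f`;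
  the cocycle and coboundary identities are preserved because `ψ` is a homomorphism);
* `mapCoeff_mk`; `res_mapCoeff` (commutes with restriction); `conj_mapCoeff` (commutes with the conjugation
  action of `σ ∈ G`); `comap_mapCoeff` (commutes with the pull-back `ContH1.comap` along `ι : G₀ → G`);
  `infl_mapCoeff` (the `φ = id` case of the latter, in `ContH1.infl` form); `mapCoeff_coeffChange`.
Elementary; classical; nothing of [EtTh] is asserted; no side is taken on [IUTchIII] Cor. 3.12.
-/

noncomputable section

namespace Literature.AnabelianGeometry.EtaleTheta

open scoped IsMulCommutative

namespace ContH1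

section CoeffHom

variable {G' G'' : Type*} [Group G'] [Group G''] (A : Subgroup G') (ψ : G' →* G'') (A'' : Subgroup G'')
  (hA : A.map ψ ≤ A'')

/-- The coefficient map `A → A″`, `a ↦ ψ a`, as a homomorphism of the coefficient groups.
[cite: NeukirchSchmidtWingberg2008, I §2 and II §7] -/
def coeffHom : A →* A'' where
  toFun a := ⟨ψ a, hA ⟨a, a.2, rfl⟩⟩
  map_one' := Subtype.ext (by simp)
  map_mul' a b := Subtype.ext (by simp)

/-- [cite: NeukirchSchmidtWingberg2008, I §2 and II §7] -/
@[simp] theorem coe_coeffHom_apply (a : A) : ((coeffHom A ψ A'' hA a : A'') : G'') = ψ a := rfl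

/-- [cite: NeukirchSchmidtWingberg2008, I §2 and II §7] -/
theorem continuous_coeffHom [TopologicalSpace G'] [TopologicalSpace G''] (hψ : Continuous ψ) :
    Continuous (coeffHom A ψ A'' hA) :=
  continuous_induced_rng.2 ((hψ.comp continuous_subtype_val).congr fun _ => rfl)

/-- The coefficient map is EQUIVARIANT: `ψ (g a g⁻¹) = ψ(g) ψ(a) ψ(g)⁻¹`. [cite: NeukirchSchmidtWingberg2008, I §2 and II §7] -/
theorem coeffHom_conjNormal [A.Normal] [A''.Normal] (g : G') (a : A) :
    coeffHom A ψ A'' hA (MulAut.conjNormal g a) = MulAut.conjNormal (ψ g) (coeffHom A ψ A'' hA a) :=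
  Subtype.ext (by simp [map_mul, map_inv])

end CoeffHom

variable {G G' G'' : Type*} [Group G] [TopologicalSpace G]
  [Group G'] [TopologicalSpace G'] [IsTopologicalGroup G']
  [Group G''] [TopologicalSpace G''] [IsTopologicalGroup G'']
  (φ : G →* G') (A : Subgroup G') [A.Normal] [IsMulCommutative A]
  (ψ : G' →* G'') (hψ : Continuous ψ) (A'' : Subgroup G'') [A''.Normal] [IsMulCommutative A'']
  (hA : A.map ψ ≤ A'') (H : Subgroup G)

/-- Push-forward of continuous cocycles along `ψ : (G′, A) → (G″, A″)`: `f ↦ ψ ∘ f`, the action on `A″` being through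
`ψ ∘ φ`. [cite: NeukirchSchmidtWingberg2008, I §2 and II §7] -/
def mapCoeffCocycle : contCocycles φ A H →* contCocycles (ψ.comp φ) A'' H where
  toFun f := ⟨fun h => coeffHom A ψ A'' hA (f.1 h), (continuous_coeffHom A ψ A'' hA hψ).comp f.2.1, fun g h => by
    show coeffHom A ψ A'' hA (f.1 (g * h)) =
      coeffHom A ψ A'' hA (f.1 g) * MulAut.conjNormal ((ψ.comp φ) (g : G)) (coeffHom A ψ A'' hA (f.1 h))
    rw [f.2.2 g h, map_mul, coeffHom_conjNormal, MonoidHom.comp_apply]⟩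
  map_one' := Subtype.ext (funext fun _ => by simp)
  map_mul' f₁ f₂ := Subtype.ext (funext fun h => by
    change coeffHom A ψ A'' hA ((f₁.1 * f₂.1) h) = coeffHom A ψ A'' hA (f₁.1 h) * coeffHom A ψ A'' hA (f₂.1 h)
    rw [Pi.mul_apply, map_mul])

/-- **`H¹(H, A) → H¹(H, A″)`, the push-forward of the coefficients along a continuous homomorphism of ambient
pairs `ψ : (G′, A) → (G″, A″)`** (coboundaries of `a` go to coboundaries of `ψ a`).  In [EtTh] Rmk 1.6.4 this is
the passage from `Δ_Θ ≤ (Π^tp_X)^Θ`-valued classes to `ι(Δ_Θ)`-valued ones along the completion `ι`.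
[cite: NeukirchSchmidtWingberg2008, I §2 and II §7] -/
def mapCoeff : ContH1 φ A H →* ContH1 (ψ.comp φ) A'' H :=
  QuotientGroup.map _ _ (mapCoeffCocycle φ A ψ hψ A'' hA H) (by
    intro f hf
    obtain ⟨a, ha⟩ := (mem_contCoboundaries_iff _).mp (Subgroup.mem_subgroupOf.mp hf)
    refine Subgroup.mem_subgroupOf.mpr ((mem_contCoboundaries_iff _).mpr ⟨coeffHom A ψ A'' hA a, ?_⟩)
    funext h
    have := congrFun ha h
    change coeffHom A ψ A'' hA (f.1 h) = _
    rw [this, map_mul, map_inv, coeffHom_conjNormal, MonoidHom.comp_apply])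

/-- `mapCoeff` on the class of a cocycle. [cite: NeukirchSchmidtWingberg2008, I §2 and II §7] -/
theorem mapCoeff_mk (f : H → A) (hf : f ∈ contCocycles φ A H) :
    mapCoeff φ A ψ hψ A'' hA H (ContH1.mk f hf) =
      ContH1.mk (fun h => coeffHom A ψ A'' hA (f h)) (mapCoeffCocycle φ A ψ hψ A'' hA H ⟨f, hf⟩).2 := rfl

/-- The value of a pushed-forward cocycle, read in `G″`: `(ψ_* f)(h) = ψ (f h)`. [cite: NeukirchSchmidtWingberg2008, I §2 and II §7] -/
theorem coe_mapCoeffCocycle_apply (f : contCocycles φ A H) (h : H) :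
    (((mapCoeffCocycle φ A ψ hψ A'' hA H f).1 h : A'') : G'') = ψ (f.1 h) := rfl

/-- `mapCoeff` commutes with restriction to a smaller subgroup. [cite: NeukirchSchmidtWingberg2008, I §2 and II §7] -/
theorem res_mapCoeff {H₁ : Subgroup G} (hle : H₁ ≤ H) (x : ContH1 φ A H) :
    ContH1.res (ψ.comp φ) A'' hle (mapCoeff φ A ψ hψ A'' hA H x) =
      mapCoeff φ A ψ hψ A'' hA H₁ (ContH1.res φ A hle x) := by
  induction x using QuotientGroup.induction_on with
  | H f => rfl

/-- `mapCoeff` commutes with the conjugation action of `σ ∈ G` (`H` normal): the acting element is the same on both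
sides, acting through `φ` resp. `ψ ∘ φ`. [cite: NeukirchSchmidtWingberg2008, I §2 and II §7] -/
theorem conj_mapCoeff [IsTopologicalGroup G] [H.Normal] (σ : G) (x : ContH1 φ A H) :
    ContH1.conj (ψ.comp φ) A'' σ (mapCoeff φ A ψ hψ A'' hA H x) =
      mapCoeff φ A ψ hψ A'' hA H (ContH1.conj φ A σ x) := by
  induction x using QuotientGroup.induction_on with
  | H f =>
    apply congrArg (QuotientGroup.mk (s := (contCoboundaries (ψ.comp φ) A'' H).subgroupOf
      (contCocycles (ψ.comp φ) A'' H)))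
    apply Subtype.ext
    funext y
    change MulAut.conjNormal ((ψ.comp φ) σ) (coeffHom A ψ A'' hA (f.1 (MulAut.conjNormal σ⁻¹ y))) =
      coeffHom A ψ A'' hA (MulAut.conjNormal (φ σ) (f.1 (MulAut.conjNormal σ⁻¹ y)))
    rw [coeffHom_conjNormal, MonoidHom.comp_apply]

/-- `mapCoeff` commutes with the coefficient change along an inclusion `A ≤ A₁` (pushed to `A″ ≤ A″₁`).
[cite: NeukirchSchmidtWingberg2008, I §2 and II §7] -/
theorem mapCoeff_coeffChange {A₁ : Subgroup G'} [A₁.Normal] [IsMulCommutative A₁] (hAA₁ : A ≤ A₁)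
    {A''₁ : Subgroup G''} [A''₁.Normal] [IsMulCommutative A''₁] (hA₁ : A₁.map ψ ≤ A''₁) (hAA''₁ : A'' ≤ A''₁)
    (x : ContH1 φ A H) :
    mapCoeff φ A₁ ψ hψ A''₁ hA₁ H (coeffChange φ hAA₁ H x) =
      coeffChange (ψ.comp φ) hAA''₁ H (mapCoeff φ A ψ hψ A'' hA H x) := by
  induction x using QuotientGroup.induction_on with
  | H f =>
    apply congrArg (QuotientGroup.mk (s := (contCoboundaries (ψ.comp φ) A''₁ H).subgroupOf
      (contCocycles (ψ.comp φ) A''₁ H)))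
    exact Subtype.ext (funext fun y => Subtype.ext rfl)

end ContH1

/-! ### Compatibility with pull-back along a homomorphism of the acting groups -/

section Comap

open ContH1

variable {G₀ G G' G'' : Type*} [Group G₀] [TopologicalSpace G₀] [Group G] [TopologicalSpace G]
  [Group G'] [TopologicalSpace G'] [IsTopologicalGroup G']
  [Group G''] [TopologicalSpace G''] [IsTopologicalGroup G'']
  (φ : G →* G') (A : Subgroup G') [A.Normal] [IsMulCommutative A]
  (ψ : G' →* G'') (hψ : Continuous ψ) (A'' : Subgroup G'') [A''.Normal] [IsMulCommutative A'']
  (hA : A.map ψ ≤ A'') (ι : G₀ →* G) (hι : Continuous ι)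

/-- **`mapCoeff` commutes with `ContH1.comap`**: pushing the coefficients forward along `ψ` and pulling the group back
along `ι : G₀ → G` commute (`(ψ ∘ φ) ∘ ι = ψ ∘ (φ ∘ ι)` definitionally).  In [EtTh] Rmk 1.6.4: the square
«complete the group, complete the coefficients». [cite: NeukirchSchmidtWingberg2008, I §2 and II §7] -/
theorem ContH1.comap_mapCoeff {H₀ : Subgroup G₀} {H : Subgroup G} (h : H₀.map ι ≤ H) (x : ContH1 φ A H) :
    ContH1.comap (ψ.comp φ) A'' ι hι h (mapCoeff φ A ψ hψ A'' hA H x) =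
      mapCoeff (φ.comp ι) A ψ hψ A'' hA H₀ (ContH1.comap φ A ι hι h x) := by
  induction x using QuotientGroup.induction_on with
  | H f => rfl

/-- The `φ = id` case in `ContH1.infl` form: inflation along `ι : G₀ → G′` commutes with the coefficient
push-forward. [cite: NeukirchSchmidtWingberg2008, I §2 and II §7] -/
theorem ContH1.infl_mapCoeff {G₀' : Type*} [Group G₀'] [TopologicalSpace G₀'] (κ : G₀' →* G') (hκ : Continuous κ)
    {H₀ : Subgroup G₀'} {H' : Subgroup G'} (h : H₀.map κ ≤ H') (x : ContH1 (MonoidHom.id G') A H') :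
    ContH1.comap (ψ.comp (MonoidHom.id G')) A'' κ hκ h (mapCoeff (MonoidHom.id G') A ψ hψ A'' hA H' x) =
      mapCoeff ((MonoidHom.id G').comp κ) A ψ hψ A'' hA H₀ (ContH1.infl A κ hκ h x) := by
  induction x using QuotientGroup.induction_on with
  | H f => rfl

end Comap

end Literature.AnabelianGeometry.EtaleTheta

end
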